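import Summits.HodgeConjecture.HodgeConjecture.Theorems.R90S3TransportDeltaTransfer   -- ★ p862979 (this seat): `isRegularElt_map_ringEquiv_iff`, `isLocalGRegular_transport_iff` (+ ★ p862896 PART 1)
import Literature.NumberTheory.Rogawski1990.LocalTransferTransportCanonical              -- ★ `OrbitalMeasureFamily.IsCanonical.transport` (generic canonical-family transport)
import Literature.NumberTheory.Rogawski1990.LocalTransferCertification                   -- ★ `isRegularElt_iff_of_isConj_local`
import Summits.HodgeConjecture.HodgeConjecture.Theorems.F0P3cStCharTSUpTrSWIFH              -- ★ `isLocalGRegular_iff_of_isConj` (G-regularity in `H_v` is a class function) — reused BY NAME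
import HarnessLib

/-!
# R90-TF · S3 wave 4 (J-S3-3), BRICK G6: CANONICAL ORBITAL-MEASURE FAMILIES PUSH FORWARD TO CANONICAL FAMILIES along a ground-field change
# (`Theorems/R90S3TransportIsCanonical.lean` — pays `stub_R90_S3_transport_isCanonical` BY NAME, outright)

Cell `hodgecm-mathlib`, crux H413 (`stmt-HodgeConjecture-24833`), route of record `HCCMUnconditional`; programme R90-TF, section S3 (base `R90-C12`), wave 4 «LOCAL TRANSPORT»
(S3-R12; dealer R90-C12-plan (g2) 23:19:08Z «G6 THEN G7 → K2E4-p14 (g11)»; socket `stub_R90_S3_transport_isCanonical` of `Cruxes/H413/Lines/R90_S3_LocalTransportWaveG.lean`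
(tree 7af8ed512a325101 :442), binders and conclusion VERBATIM below).  Lane `--supports stmt-HodgeConjecture-24833 --as helper`; THEOREMS ONLY (no definition, no instance,
no notation, no `sorry`); ★-only imports (no `Cruxes/…/Lines`); ns `…R90.S3`.  Pay line (G ED. 2): `stub_R90_S3_transport_isCanonical ‹binders› := isCanonical_transport ‹same›`.

THE MATHEMATICS [Rogawski1990 §4.3 (4.3.1) p. 43; DeitmarEchterhoff2014 Thm. 1.5.3].  A family of orbital measures is CANONICAL on the `P`-classes for a Haar measure `ν` (★
`OrbitalMeasureFamily.IsCanonical`) when at each `P`-class it is the quotient of `ν` by the normalised Haar measure of the centraliser.  ★ `IsCanonical.transport` (generic, for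
a bicontinuous `ψ : B ≃* A`, a class function `Q` on `B` with `P a → Q (ψ⁻¹ a)`, and `ν = ψ_* ν′`) transports canonicity to the pushed-forward family `ψ_* m′`.  Here, twice:
on the `G`-side with `ψ = e₃`, `P = Q =` «regular» (a class function, ★ `isRegularElt_iff_of_isConj_local`; `P a → Q (e₃⁻¹ a)` because `e₃` acts entrywise by `Φ` (`he₃`) and
regularity is `Φ`-invariant, ★ `isRegularElt_map_ringEquiv_iff`); on the `H`-side with `ψ = e_H`, `P = Q =` «`G`-regular» (a class function because `ι : H → U(Φ₃)` is a
homomorphism and regularity is a class function, ★ `isRegularElt_of_isConj`; `P a → Q (e_H⁻¹ a)` by ★ `isLocalGRegular_transport_iff`).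
* HEAD **`isCanonical_transport`** = the socket's statement (the class-function input on the `H`-side is ★ `F0P3cStCharTSUpTrSWIFH.isLocalGRegular_iff_of_isConj`, reused).
HONEST LABEL: transport-of-structure bookkeeping, no print input; HC_CM is proved only modulo the 7 printed citations (2 remaining named inputs: hLiu418 = stmt-HodgeConjecture-24832,
h413 = stmt-HodgeConjecture-24833) until rung 0 closes; count-neutral helper.

## References
* [Rogawski1990] J. D. Rogawski, *Automorphic Representations of Unitary Groups in Three Variables*, Ann. of Math. Stud. 123 (1990), §4.3 (4.3.1) p. 43 (normalised measures on
  `G_γ \ G`); §14.2 p. 232.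
* [DeitmarEchterhoff2014] A. Deitmar, S. Echterhoff, *Principles of Harmonic Analysis*, 2nd ed. (2014), Thm. 1.5.3 (quotient measures).
-/

set_option autoImplicit false
-- the mandated namespace repeats the single-problem summit's segment (`HodgeConjecture.HodgeConjecture`)
set_option linter.dupNamespace false

noncomputable section

open MeasureTheory Topology IsDedekindDomain NumberField
open Literature.NumberTheory Literature.NumberTheory.Automorphic Literature.NumberTheory.Automorphic.UnitaryGroup
open Literature.NumberTheory.Rogawski1990 Literature.NumberTheory.GaloisRepresentations
open scoped Matrix MatrixGroups
open Summit.HodgeConjecture.HodgeConjecture.Cruxes.H413.F0P3cStCharTSUpTrSWIFH (isLocalGRegular_iff_of_isConj)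

namespace Summit.HodgeConjecture.HodgeConjecture.R90.S3

variable (L : Type) [Field L] [NumberField L] [IsCMField L] (H' : Matrix (Fin 3) (Fin 3) L)
  (v : HeightOneSpectrum (𝓞 ↥(maximalRealSubfield L)))

/-- **BRICK G6 — CANONICAL FAMILIES PUSH FORWARD TO CANONICAL FAMILIES** (socket `stub_R90_S3_transport_isCanonical`, binders and conclusion VERBATIM): the `hm` hypothesis
of E's sockets at `(L, v)` yields the `hm` hypothesis at `(L′, v′)` for `(e_{H*} m_H, e_{3*} m_G)` and the push-forward Haar measures.  Two uses of ★ `IsCanonical.transport`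
(see the module docstring for the class-function and `P → Q ∘ ψ⁻¹` inputs). [cite: Rogawski1990, §4.3 (4.3.1) p. 43; §14.2 p. 232] [cite: DeitmarEchterhoff2014, Thm. 1.5.3] -/
theorem isCanonical_transport
    (L' : Type) [Field L'] [NumberField L'] [IsCMField L'] (v' : HeightOneSpectrum (𝓞 ↥(maximalRealSubfield L')))
    (Φ : UnitaryGroup.LocalRing L v ≃+* UnitaryGroup.LocalRing L' v') (_hc : Continuous Φ) (_hc' : Continuous Φ.symm)
    (_hΦσ : ∀ x, Φ ((conjLocal L (IsCMField.complexConj L) v) x) = (conjLocal L' (IsCMField.complexConj L') v') (Φ x))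
    (H'' : Matrix (Fin 3) (Fin 3) L')
    (_hΦH : (H'.map (algebraMap L (UnitaryGroup.LocalRing L v))).map Φ = H''.map (algebraMap L' (UnitaryGroup.LocalRing L' v')))
    (e₃ : (UnitaryGroup.cmDatum L 3 H').Local v ≃ₜ* (UnitaryGroup.cmDatum L' 3 H'').Local v')
    (he₃ : ∀ g, ((e₃ g).val : GL (Fin 3) (UnitaryGroup.LocalRing L' v')) = Matrix.GeneralLinearGroup.map (Φ : UnitaryGroup.LocalRing L v →+* UnitaryGroup.LocalRing L' v') (g.val : GL (Fin 3) (UnitaryGroup.LocalRing L v)))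
    (e₂ : (UnitaryGroup.cmDatum L 2 (Matrix.of fun i j : Fin 2 => if i.val + j.val + 1 = 2 then (1 : L) else 0)).Local v ≃ₜ*
      (UnitaryGroup.cmDatum L' 2 (Matrix.of fun i j : Fin 2 => if i.val + j.val + 1 = 2 then (1 : L') else 0)).Local v')
    (he₂ : ∀ g, ((e₂ g).val : GL (Fin 2) (UnitaryGroup.LocalRing L' v')) = Matrix.GeneralLinearGroup.map (Φ : UnitaryGroup.LocalRing L v →+* UnitaryGroup.LocalRing L' v') (g.val : GL (Fin 2) (UnitaryGroup.LocalRing L v)))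
    (e₁ : (UnitaryGroup.cmDatum L 1 (Matrix.of fun i j : Fin 1 => if i.val + j.val + 1 = 1 then (1 : L) else 0)).Local v ≃ₜ*
      (UnitaryGroup.cmDatum L' 1 (Matrix.of fun i j : Fin 1 => if i.val + j.val + 1 = 1 then (1 : L') else 0)).Local v')
    (he₁ : ∀ g, ((e₁ g).val : GL (Fin 1) (UnitaryGroup.LocalRing L' v')) = Matrix.GeneralLinearGroup.map (Φ : UnitaryGroup.LocalRing L v →+* UnitaryGroup.LocalRing L' v') (g.val : GL (Fin 1) (UnitaryGroup.LocalRing L v)))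
    (eH : ((UnitaryGroup.cmDatum L 2 (Matrix.of fun i j : Fin 2 => if i.val + j.val + 1 = 2 then (1 : L) else 0)).Local v ×
      (UnitaryGroup.cmDatum L 1 (Matrix.of fun i j : Fin 1 => if i.val + j.val + 1 = 1 then (1 : L) else 0)).Local v) ≃ₜ*
      ((UnitaryGroup.cmDatum L' 2 (Matrix.of fun i j : Fin 2 => if i.val + j.val + 1 = 2 then (1 : L') else 0)).Local v' ×
      (UnitaryGroup.cmDatum L' 1 (Matrix.of fun i j : Fin 1 => if i.val + j.val + 1 = 1 then (1 : L') else 0)).Local v'))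
    (heH : ∀ h, eH h = (e₂ h.1, e₁ h.2))
    [MeasurableSpace ((UnitaryGroup.cmDatum L 3 H').Local v)] [BorelSpace ((UnitaryGroup.cmDatum L 3 H').Local v)]
    [∀ γ : ((UnitaryGroup.cmDatum L 3 H').Local v), MeasurableSpace (((UnitaryGroup.cmDatum L 3 H').Local v) ⧸ Subgroup.centralizer ({γ} : Set ((UnitaryGroup.cmDatum L 3 H').Local v)))]
    [∀ γ : ((UnitaryGroup.cmDatum L 3 H').Local v), BorelSpace (((UnitaryGroup.cmDatum L 3 H').Local v) ⧸ Subgroup.centralizer ({γ} : Set ((UnitaryGroup.cmDatum L 3 H').Local v)))]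
    [MeasurableSpace ((UnitaryGroup.cmDatum L 2 (Matrix.of fun i j : Fin 2 => if i.val + j.val + 1 = 2 then (1 : L) else 0)).Local v ×
      (UnitaryGroup.cmDatum L 1 (Matrix.of fun i j : Fin 1 => if i.val + j.val + 1 = 1 then (1 : L) else 0)).Local v)] [BorelSpace ((UnitaryGroup.cmDatum L 2 (Matrix.of fun i j : Fin 2 => if i.val + j.val + 1 = 2 then (1 : L) else 0)).Local v ×
      (UnitaryGroup.cmDatum L 1 (Matrix.of fun i j : Fin 1 => if i.val + j.val + 1 = 1 then (1 : L) else 0)).Local v)]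
    [∀ a : ((UnitaryGroup.cmDatum L 2 (Matrix.of fun i j : Fin 2 => if i.val + j.val + 1 = 2 then (1 : L) else 0)).Local v ×
      (UnitaryGroup.cmDatum L 1 (Matrix.of fun i j : Fin 1 => if i.val + j.val + 1 = 1 then (1 : L) else 0)).Local v),
      MeasurableSpace (((UnitaryGroup.cmDatum L 2 (Matrix.of fun i j : Fin 2 => if i.val + j.val + 1 = 2 then (1 : L) else 0)).Local v ×
      (UnitaryGroup.cmDatum L 1 (Matrix.of fun i j : Fin 1 => if i.val + j.val + 1 = 1 then (1 : L) else 0)).Local v) ⧸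
        Subgroup.centralizer ({a} : Set ((UnitaryGroup.cmDatum L 2 (Matrix.of fun i j : Fin 2 => if i.val + j.val + 1 = 2 then (1 : L) else 0)).Local v ×
      (UnitaryGroup.cmDatum L 1 (Matrix.of fun i j : Fin 1 => if i.val + j.val + 1 = 1 then (1 : L) else 0)).Local v)))]
    [∀ a : ((UnitaryGroup.cmDatum L 2 (Matrix.of fun i j : Fin 2 => if i.val + j.val + 1 = 2 then (1 : L) else 0)).Local v ×
      (UnitaryGroup.cmDatum L 1 (Matrix.of fun i j : Fin 1 => if i.val + j.val + 1 = 1 then (1 : L) else 0)).Local v),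
      BorelSpace (((UnitaryGroup.cmDatum L 2 (Matrix.of fun i j : Fin 2 => if i.val + j.val + 1 = 2 then (1 : L) else 0)).Local v ×
      (UnitaryGroup.cmDatum L 1 (Matrix.of fun i j : Fin 1 => if i.val + j.val + 1 = 1 then (1 : L) else 0)).Local v) ⧸
        Subgroup.centralizer ({a} : Set ((UnitaryGroup.cmDatum L 2 (Matrix.of fun i j : Fin 2 => if i.val + j.val + 1 = 2 then (1 : L) else 0)).Local v ×
      (UnitaryGroup.cmDatum L 1 (Matrix.of fun i j : Fin 1 => if i.val + j.val + 1 = 1 then (1 : L) else 0)).Local v)))]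
    [MeasurableSpace ((UnitaryGroup.cmDatum L' 3 H'').Local v')] [BorelSpace ((UnitaryGroup.cmDatum L' 3 H'').Local v')]
    [∀ γ : ((UnitaryGroup.cmDatum L' 3 H'').Local v'), MeasurableSpace (((UnitaryGroup.cmDatum L' 3 H'').Local v') ⧸ Subgroup.centralizer ({γ} : Set ((UnitaryGroup.cmDatum L' 3 H'').Local v')))]
    [∀ γ : ((UnitaryGroup.cmDatum L' 3 H'').Local v'), BorelSpace (((UnitaryGroup.cmDatum L' 3 H'').Local v') ⧸ Subgroup.centralizer ({γ} : Set ((UnitaryGroup.cmDatum L' 3 H'').Local v')))]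
    [MeasurableSpace ((UnitaryGroup.cmDatum L' 2 (Matrix.of fun i j : Fin 2 => if i.val + j.val + 1 = 2 then (1 : L') else 0)).Local v' ×
      (UnitaryGroup.cmDatum L' 1 (Matrix.of fun i j : Fin 1 => if i.val + j.val + 1 = 1 then (1 : L') else 0)).Local v')] [BorelSpace ((UnitaryGroup.cmDatum L' 2 (Matrix.of fun i j : Fin 2 => if i.val + j.val + 1 = 2 then (1 : L') else 0)).Local v' ×
      (UnitaryGroup.cmDatum L' 1 (Matrix.of fun i j : Fin 1 => if i.val + j.val + 1 = 1 then (1 : L') else 0)).Local v')]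
    [∀ a : ((UnitaryGroup.cmDatum L' 2 (Matrix.of fun i j : Fin 2 => if i.val + j.val + 1 = 2 then (1 : L') else 0)).Local v' ×
      (UnitaryGroup.cmDatum L' 1 (Matrix.of fun i j : Fin 1 => if i.val + j.val + 1 = 1 then (1 : L') else 0)).Local v'),
      MeasurableSpace (((UnitaryGroup.cmDatum L' 2 (Matrix.of fun i j : Fin 2 => if i.val + j.val + 1 = 2 then (1 : L') else 0)).Local v' ×
      (UnitaryGroup.cmDatum L' 1 (Matrix.of fun i j : Fin 1 => if i.val + j.val + 1 = 1 then (1 : L') else 0)).Local v') ⧸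
        Subgroup.centralizer ({a} : Set ((UnitaryGroup.cmDatum L' 2 (Matrix.of fun i j : Fin 2 => if i.val + j.val + 1 = 2 then (1 : L') else 0)).Local v' ×
      (UnitaryGroup.cmDatum L' 1 (Matrix.of fun i j : Fin 1 => if i.val + j.val + 1 = 1 then (1 : L') else 0)).Local v')))]
    [∀ a : ((UnitaryGroup.cmDatum L' 2 (Matrix.of fun i j : Fin 2 => if i.val + j.val + 1 = 2 then (1 : L') else 0)).Local v' ×
      (UnitaryGroup.cmDatum L' 1 (Matrix.of fun i j : Fin 1 => if i.val + j.val + 1 = 1 then (1 : L') else 0)).Local v'),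
      BorelSpace (((UnitaryGroup.cmDatum L' 2 (Matrix.of fun i j : Fin 2 => if i.val + j.val + 1 = 2 then (1 : L') else 0)).Local v' ×
      (UnitaryGroup.cmDatum L' 1 (Matrix.of fun i j : Fin 1 => if i.val + j.val + 1 = 1 then (1 : L') else 0)).Local v') ⧸
        Subgroup.centralizer ({a} : Set ((UnitaryGroup.cmDatum L' 2 (Matrix.of fun i j : Fin 2 => if i.val + j.val + 1 = 2 then (1 : L') else 0)).Local v' ×
      (UnitaryGroup.cmDatum L' 1 (Matrix.of fun i j : Fin 1 => if i.val + j.val + 1 = 1 then (1 : L') else 0)).Local v')))]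
    (νG : Measure ((UnitaryGroup.cmDatum L 3 H').Local v)) [νG.IsHaarMeasure] [νG.IsMulRightInvariant]
    (νH : Measure ((UnitaryGroup.cmDatum L 2 (Matrix.of fun i j : Fin 2 => if i.val + j.val + 1 = 2 then (1 : L) else 0)).Local v ×
      (UnitaryGroup.cmDatum L 1 (Matrix.of fun i j : Fin 1 => if i.val + j.val + 1 = 1 then (1 : L) else 0)).Local v))
    [νH.IsHaarMeasure] [νH.IsMulRightInvariant]
    (mH : OrbitalMeasureFamily ((UnitaryGroup.cmDatum L 2 (Matrix.of fun i j : Fin 2 => if i.val + j.val + 1 = 2 then (1 : L) else 0)).Local v ×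
      (UnitaryGroup.cmDatum L 1 (Matrix.of fun i j : Fin 1 => if i.val + j.val + 1 = 1 then (1 : L) else 0)).Local v))
    (mG : OrbitalMeasureFamily ((UnitaryGroup.cmDatum L 3 H').Local v))
    (νG' : Measure ((UnitaryGroup.cmDatum L' 3 H'').Local v')) [νG'.IsHaarMeasure] [νG'.IsMulRightInvariant] (hνG' : νG' = νG.map e₃)
    (νH' : Measure ((UnitaryGroup.cmDatum L' 2 (Matrix.of fun i j : Fin 2 => if i.val + j.val + 1 = 2 then (1 : L') else 0)).Local v' ×
      (UnitaryGroup.cmDatum L' 1 (Matrix.of fun i j : Fin 1 => if i.val + j.val + 1 = 1 then (1 : L') else 0)).Local v'))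
    [νH'.IsHaarMeasure] [νH'.IsMulRightInvariant] (hνH' : νH' = νH.map eH)
    (hm : mH.IsCanonical (IsLocalGRegular L v) νH ∧
      mG.IsCanonical (fun γ => IsRegularElt (γ.val : GL (Fin 3) (UnitaryGroup.LocalRing L v))) νG) :
    (mH.transport eH.toMulEquiv eH.continuous eH.symm.continuous).IsCanonical (IsLocalGRegular L' v') νH' ∧
      (mG.transport e₃.toMulEquiv e₃.continuous e₃.symm.continuous).IsCanonical
        (fun γ => IsRegularElt (γ.val : GL (Fin 3) (UnitaryGroup.LocalRing L' v'))) νG' := by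
  obtain ⟨hmH, hmG⟩ := hm
  refine ⟨?_, ?_⟩
  · exact hmH.transport eH.toMulEquiv eH.continuous eH.symm.continuous
      (fun b b' h => isLocalGRegular_iff_of_isConj h)
      (fun a ha => (isLocalGRegular_transport_iff L v L' v' Φ e₂ he₂ e₁ he₁ eH heH (eH.symm a)).1
        (by rw [ContinuousMulEquiv.apply_symm_apply]; exact ha))
      νH νH' hνH'
  · exact hmG.transport e₃.toMulEquiv e₃.continuous e₃.symm.continuous
      (fun b b' h => isRegularElt_iff_of_isConj_local L H' v h)
      (fun a ha => (isRegularElt_map_ringEquiv_iff Φ ((e₃.symm a).val : GL (Fin 3) (UnitaryGroup.LocalRing L v))).1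
        (by rw [← he₃ (e₃.symm a), ContinuousMulEquiv.apply_symm_apply]; exact ha))
      νG νG' hνG'

end Summit.HodgeConjecture.HodgeConjecture.R90.S3

end
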